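import Summits.CriticalPhenomena.PercolationContinuityZ3.Theorems.PercNearOneGluingNoHeavyLowerTailAntitheticPairCertificate
import Summits.CriticalPhenomena.PercolationContinuityZ3.Theorems.PercNearOneGluingNoHeavyLowerTailAntitheticCutVertex
import HarnessLib

/-!
# `NoHeavyLowerTail` (stmt-CriticalPhenomena-4575) — antithetic cluster pairs: TRANSPORT of ⊕ / mixed certificates along a vertex
# embedding (a checked certificate on `Fin k` serves the gadget inside ANY finite vertex type; prim-hp-2 gen 64, HOME/MEMO-gen64.md §3)

Support file (`--supports stmt-CriticalPhenomena-4575`, hull-port prover `prim-hp-2`, gen 64).  No definitions, no named facts, no sorries;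
standard axioms.  VERTEX version; 𝒮 = twisted-monotone super-odd test functions.

The checked pair-cube certificates of gens 58/59 (…AntitheticW4Oplus, …ConeP3MidOplus, …K23Oplus, …; format …AntitheticVectorCert) state
⊕-positivity in POWERSET FORM on a concrete `Fin k`: `0 ≤ Σ_{θ ⊆ E₁, y ∈ X θ} K₁K₂(C_s(θ), C_s(E₁ ∖ θ))`.  The structural theorems
(dual handle theorem …AntitheticHandleDual, cut-vertex composition …AntitheticCutVertex, 1-sum lemma …AntitheticOneSum) consume
⊕-positivity in COLOURING FORM over an arbitrary finite vertex type `V`: `0 ≤ Σ_{T : Set (Sym2 V), P ∈ X_E T} K₁K₂(X_E T, Y_E T)`.  This file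
bridges the two once and for all:
* `Antithetic.Transport.cluster_image` — for an injective `φ : V₀ → V` and `θ ⊆ Sym2 V₀`, the cluster of `φ s₀` in `Sym2.map φ '' θ` is
  `φ '' C_{s₀}(θ)`; `mem_cluster_image_iff`.
* `Antithetic.Transport.event_sum_of_powerset` — GENERIC TRANSPORT: a powerset-form positivity statement on `V₀` for an event
  `ev₀ (X, Y)` and all `K ∈ 𝒮(V₀)` yields the colouring-form statement on `V` for the image edge set `E = Sym2.map φ '' E₁`, the event `ev`
  (compatible: `ev (φ '' A) (φ '' B) ↔ ev₀ A B`) and all `K ∈ 𝒮(V)` — pull `K` back along `φ` (pull-backs of 𝒮(V) lie in 𝒮(V₀)), reindex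
  the powerset of `E` by that of `E₁`, and pass from `η ⊆ E` to all colourings by `Antithetic.sum_filter_inter_nonneg`.
* `Antithetic.Transport.oplus_of_powerset` (event `y ∈ X`) and `Antithetic.Transport.mixed_of_powerset` (event `y ∈ X ∧ z ∉ Y`): the two
  shapes used by the handle theorems.
[cite: VandenbergHaggstromKahn2005, §1 p. 6 ("Harris' inequality"), §1 p. 3 (open cluster `C_s`)]
-/

noncomputable section

namespace Summit.CriticalPhenomena.PercolationContinuityZ3.Theorems

open Literature.Probability.Percolation
open scoped Classical

namespace Antithetic

namespace Transport

variable {V₀ V : Type*} {φ : V₀ → V} (hφ : Function.Injective φ)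
include hφ

/-- Adjacency in the image configuration: `(fromEdgeSet (Sym2.map φ '' θ)).Adj u w` iff `u = φ a`, `w = φ b` for an edge `ab` of `θ`.
[folklore] -/
theorem adj_image_iff (θ : Set (Sym2 V₀)) (u w : V) :
    (openGraph (Sym2.map φ '' θ)).Adj u w ↔ ∃ a b, (openGraph θ).Adj a b ∧ φ a = u ∧ φ b = w := by
  constructor
  · intro h
    rw [openGraph_adj] at h
    obtain ⟨⟨e, he, heq⟩, hne⟩ := h
    induction e using Sym2.ind with
    | h a b =>
      rw [Sym2.map_mk, Sym2.eq_iff] at heq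
      rcases heq with ⟨h1, h2⟩ | ⟨h1, h2⟩
      · refine ⟨a, b, ?_, h1, h2⟩
        rw [openGraph_adj]
        exact ⟨he, fun hab => hne (by rw [← h1, ← h2, hab])⟩
      · refine ⟨b, a, ?_, h2, h1⟩
        rw [openGraph_adj, Sym2.eq_swap]
        exact ⟨he, fun hab => hne (by rw [← h1, ← h2, hab])⟩
  · rintro ⟨a, b, hab, rfl, rfl⟩
    rw [openGraph_adj] at hab ⊢
    exact ⟨⟨s(a, b), hab.1, Sym2.map_mk φ a b⟩, fun h => hab.2 (hφ h)⟩

/-- **Clusters of the image configuration**: `C_{φ s₀}(Sym2.map φ '' θ) = φ '' C_{s₀}(θ)`. [folklore] -/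
theorem cluster_image (θ : Set (Sym2 V₀)) (s₀ : V₀) :
    openCluster (Sym2.map φ '' θ) (φ s₀) = φ '' openCluster θ s₀ := by
  apply Set.Subset.antisymm
  · intro u hu
    refine Cut.reach_closed' (Gr := openGraph (Sym2.map φ '' θ)) (P := fun u => u ∈ φ '' openCluster θ s₀) ?_ hu
      ⟨s₀, mem_openCluster_self _ _, rfl⟩
    rintro u w ⟨a, ha, rfl⟩ huw
    obtain ⟨a', b, hab, h1, rfl⟩ := (adj_image_iff hφ θ (φ a) w).1 huw
    have : a' = a := hφ h1
    subst this
    exact ⟨b, SimpleGraph.Reachable.trans ha hab.reachable, rfl⟩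
  · rintro u ⟨a, ha, rfl⟩
    let f : openGraph θ →g openGraph (Sym2.map φ '' θ) :=
      { toFun := φ
        map_rel' := fun {a b} hab => (adj_image_iff hφ θ (φ a) (φ b)).2 ⟨a, b, hab, rfl, rfl⟩ }
    exact SimpleGraph.Reachable.map f ha

/-- `φ v` lies in the image cluster iff `v` lies in the cluster. [folklore] -/
theorem mem_cluster_image_iff (θ : Set (Sym2 V₀)) (s₀ v : V₀) :
    φ v ∈ openCluster (Sym2.map φ '' θ) (φ s₀) ↔ v ∈ openCluster θ s₀ := by
  rw [cluster_image hφ, hφ.mem_set_image]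

variable [Fintype V] (E₁ : Finset (Sym2 V₀)) (s₀ : V₀)

/-- **Generic transport.**  `ev₀` an event on pairs of `V₀`-sets, `ev` an event on pairs of `V`-sets with `ev (φ '' A) (φ '' B) ↔ ev₀ A B`.
If `Σ_{θ ⊆ E₁, ev₀(C(θ), C(E₁∖θ))} K₁K₂(C_{s₀}(θ), C_{s₀}(E₁∖θ)) ≥ 0` for all `K₁, K₂ ∈ 𝒮(V₀)` (powerset form), then for the image edge
set `E = Sym2.map φ '' E₁` in `V`: `Σ_{T : ev(X_E T, Y_E T)} K₁K₂(X_E T, Y_E T) ≥ 0` for all `K₁, K₂ ∈ 𝒮(V)` (colouring form,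
`X_E T = C_{φ s₀}(T ∩ E)`, `Y_E T = C_{φ s₀}(Tᶜ ∩ E)`). [this work] -/
theorem event_sum_of_powerset (ev₀ : Set V₀ → Set V₀ → Prop) (ev : Set V → Set V → Prop)
    (hev : ∀ A B : Set V₀, ev (φ '' A) (φ '' B) ↔ ev₀ A B)
    (hcert : ∀ K₁ K₂ : Set V₀ → Set V₀ → ℝ,
      (∀ ⦃A A' B B' : Set V₀⦄, A ⊆ A' → B' ⊆ B → K₁ A B ≤ K₁ A' B') → (∀ A B, 0 ≤ K₁ A B + K₁ B A) →
      (∀ ⦃A A' B B' : Set V₀⦄, A ⊆ A' → B' ⊆ B → K₂ A B ≤ K₂ A' B') → (∀ A B, 0 ≤ K₂ A B + K₂ B A) →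
      0 ≤ ∑ θ ∈ E₁.powerset.filter (fun θ : Finset (Sym2 V₀) =>
          ev₀ (openCluster (↑θ : Set (Sym2 V₀)) s₀) (openCluster (↑(E₁ \ θ) : Set (Sym2 V₀)) s₀)),
        K₁ (openCluster (↑θ : Set (Sym2 V₀)) s₀) (openCluster (↑(E₁ \ θ) : Set (Sym2 V₀)) s₀) *
          K₂ (openCluster (↑θ : Set (Sym2 V₀)) s₀) (openCluster (↑(E₁ \ θ) : Set (Sym2 V₀)) s₀))
    {E : Set (Sym2 V)} (hE : E = Sym2.map φ '' ↑E₁)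
    (K₁ K₂ : Set V → Set V → ℝ)
    (hK₁ : ∀ ⦃A A' B B' : Set V⦄, A ⊆ A' → B' ⊆ B → K₁ A B ≤ K₁ A' B') (hso₁ : ∀ A B, 0 ≤ K₁ A B + K₁ B A)
    (hK₂ : ∀ ⦃A A' B B' : Set V⦄, A ⊆ A' → B' ⊆ B → K₂ A B ≤ K₂ A' B') (hso₂ : ∀ A B, 0 ≤ K₂ A B + K₂ B A) :
    0 ≤ ∑ T ∈ Finset.univ.filter (fun T : Set (Sym2 V) =>
        ev (openCluster (T ∩ E) (φ s₀)) (openCluster (Tᶜ ∩ E) (φ s₀))),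
      K₁ (openCluster (T ∩ E) (φ s₀)) (openCluster (Tᶜ ∩ E) (φ s₀)) *
        K₂ (openCluster (T ∩ E) (φ s₀)) (openCluster (Tᶜ ∩ E) (φ s₀)) := by
  have hφ' : Function.Injective (Sym2.map φ) := Sym2.map.injective hφ
  -- pull back the test functions
  let L₁ : Set V₀ → Set V₀ → ℝ := fun A B => K₁ (φ '' A) (φ '' B)
  let L₂ : Set V₀ → Set V₀ → ℝ := fun A B => K₂ (φ '' A) (φ '' B)
  have hL₁ : ∀ ⦃A A' B B' : Set V₀⦄, A ⊆ A' → B' ⊆ B → L₁ A B ≤ L₁ A' B' :=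
    fun A A' B B' hA hB => hK₁ (Set.image_mono hA) (Set.image_mono hB)
  have hL₂ : ∀ ⦃A A' B B' : Set V₀⦄, A ⊆ A' → B' ⊆ B → L₂ A B ≤ L₂ A' B' :=
    fun A A' B B' hA hB => hK₂ (Set.image_mono hA) (Set.image_mono hB)
  have hpos := hcert L₁ L₂ hL₁ (fun A B => hso₁ _ _) hL₂ (fun A B => hso₂ _ _)
  -- from colourings to sub-configurations of `E`
  have hc : ∀ T : Set (Sym2 V), Tᶜ ∩ E = E \ (T ∩ E) := fun T => compl_inter_eq_diff T E
  simp_rw [hc]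
  refine sum_filter_inter_nonneg E (fun η => ev (openCluster η (φ s₀)) (openCluster (E \ η) (φ s₀)))
    (fun η => K₁ (openCluster η (φ s₀)) (openCluster (E \ η) (φ s₀)) * K₂ (openCluster η (φ s₀)) (openCluster (E \ η) (φ s₀))) ?_
  -- reindex the sub-configurations of `E` by those of `E₁`
  let ι : Finset (Sym2 V₀) → Set (Sym2 V) := fun θ => Sym2.map φ '' ↑θ
  have hιinj : Function.Injective ι := fun θ₁ θ₂ h => Finset.coe_injective ((Set.image_injective.2 hφ') h)
  have hclus : ∀ θ : Finset (Sym2 V₀), openCluster (ι θ) (φ s₀) = φ '' openCluster (↑θ : Set (Sym2 V₀)) s₀ :=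
    fun θ => cluster_image hφ _ s₀
  have hdiff : ∀ θ : Finset (Sym2 V₀), θ ⊆ E₁ → E \ ι θ = ι (E₁ \ θ) := by
    intro θ _
    show E \ Sym2.map φ '' ↑θ = Sym2.map φ '' ↑(E₁ \ θ)
    rw [hE, Finset.coe_sdiff, Set.image_sdiff hφ']
  have hset : (Finset.univ.filter fun η : Set (Sym2 V) => η ⊆ E).filter
        (fun η => ev (openCluster η (φ s₀)) (openCluster (E \ η) (φ s₀))) =
      (E₁.powerset.filter (fun θ : Finset (Sym2 V₀) =>
          ev₀ (openCluster (↑θ : Set (Sym2 V₀)) s₀) (openCluster (↑(E₁ \ θ) : Set (Sym2 V₀)) s₀))).image ι := by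
    ext η
    simp only [Finset.mem_filter, Finset.mem_univ, true_and, Finset.mem_image, Finset.mem_powerset]
    constructor
    · rintro ⟨hsub, hp⟩
      -- `η ⊆ E` is the image of `θ = {e ∈ E₁ | Sym2.map φ e ∈ η}`
      let θ : Finset (Sym2 V₀) := E₁.filter fun e => Sym2.map φ e ∈ η
      have hθ : ι θ = η := by
        ext f
        simp only [ι, θ, Finset.coe_filter, Set.mem_image, Set.mem_setOf_eq]
        constructor
        · rintro ⟨e, ⟨-, he⟩, rfl⟩; exact he
        · intro hf
          have hfE : f ∈ E := hsub hf
          rw [hE] at hfE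
          obtain ⟨e, he, rfl⟩ := hfE
          exact ⟨e, ⟨he, hf⟩, rfl⟩
      refine ⟨θ, ⟨⟨Finset.filter_subset _ _, ?_⟩, hθ⟩⟩
      rw [← hev, ← hclus θ, ← hclus (E₁ \ θ), ← hdiff θ (Finset.filter_subset _ _), hθ]
      exact hp
    · rintro ⟨θ, ⟨hθ, hp⟩, rfl⟩
      refine ⟨?_, ?_⟩
      · show Sym2.map φ '' ↑θ ⊆ E
        rw [hE]; exact Set.image_mono (Finset.coe_subset.2 hθ)
      · rw [hdiff θ hθ, hclus θ, hclus (E₁ \ θ), hev]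
        exact hp
  rw [hset, Finset.sum_image (fun θ₁ _ θ₂ _ h => hιinj h)]
  -- the summands agree with the pulled-back ones
  refine le_of_le_of_eq hpos (Finset.sum_congr rfl fun θ hθ => ?_)
  have hθE : θ ⊆ E₁ := Finset.mem_powerset.1 (Finset.mem_filter.1 hθ).1
  simp only [L₁, L₂]
  rw [hdiff θ hθE, hclus θ, hclus (E₁ \ θ)]

/-- **Transport of ⊕-positivity** (event `y ∈ X`): a powerset-form ⊕-certificate for `(E₁, s₀, y₀)` on `V₀` gives ⊕-positivity of
`(Sym2.map φ '' E₁, φ s₀, φ y₀)` in colouring form on `V`. [this work] -/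
theorem oplus_of_powerset (y₀ : V₀)
    (hcert : ∀ K₁ K₂ : Set V₀ → Set V₀ → ℝ,
      (∀ ⦃A A' B B' : Set V₀⦄, A ⊆ A' → B' ⊆ B → K₁ A B ≤ K₁ A' B') → (∀ A B, 0 ≤ K₁ A B + K₁ B A) →
      (∀ ⦃A A' B B' : Set V₀⦄, A ⊆ A' → B' ⊆ B → K₂ A B ≤ K₂ A' B') → (∀ A B, 0 ≤ K₂ A B + K₂ B A) →
      0 ≤ ∑ θ ∈ E₁.powerset.filter (fun θ : Finset (Sym2 V₀) =>
          (SimpleGraph.fromEdgeSet (↑θ : Set (Sym2 V₀))).Reachable s₀ y₀),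
        K₁ (openCluster (↑θ : Set (Sym2 V₀)) s₀) (openCluster (↑(E₁ \ θ) : Set (Sym2 V₀)) s₀) *
          K₂ (openCluster (↑θ : Set (Sym2 V₀)) s₀) (openCluster (↑(E₁ \ θ) : Set (Sym2 V₀)) s₀))
    {E : Set (Sym2 V)} (hE : E = Sym2.map φ '' ↑E₁)
    (K₁ K₂ : Set V → Set V → ℝ)
    (hK₁ : ∀ ⦃A A' B B' : Set V⦄, A ⊆ A' → B' ⊆ B → K₁ A B ≤ K₁ A' B') (hso₁ : ∀ A B, 0 ≤ K₁ A B + K₁ B A)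
    (hK₂ : ∀ ⦃A A' B B' : Set V⦄, A ⊆ A' → B' ⊆ B → K₂ A B ≤ K₂ A' B') (hso₂ : ∀ A B, 0 ≤ K₂ A B + K₂ B A) :
    0 ≤ ∑ T ∈ Finset.univ.filter (fun T : Set (Sym2 V) => φ y₀ ∈ openCluster (T ∩ E) (φ s₀)),
      K₁ (openCluster (T ∩ E) (φ s₀)) (openCluster (Tᶜ ∩ E) (φ s₀)) *
        K₂ (openCluster (T ∩ E) (φ s₀)) (openCluster (Tᶜ ∩ E) (φ s₀)) := by
  have h := event_sum_of_powerset hφ E₁ s₀ (fun A _ => y₀ ∈ A) (fun A _ => φ y₀ ∈ A) (fun A B => hφ.mem_set_image) ?_ hE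
    K₁ K₂ hK₁ hso₁ hK₂ hso₂
  · convert h using 3
  · intro L₁ L₂ hL₁ hsoL₁ hL₂ hsoL₂
    have h' := hcert L₁ L₂ hL₁ hsoL₁ hL₂ hsoL₂
    convert h' using 3
    unfold openCluster openGraph; exact Iff.rfl

/-- **Transport of the mixed sum** (event `y ∈ X ∧ z ∉ Y`): a powerset-form certificate on `V₀` gives the colouring-form statement
`Σ_{T : φ y₀ ∈ X_E T, φ z₀ ∉ Y_E T} K₁K₂ ≥ 0` on `V`. [this work] -/
theorem mixed_of_powerset (y₀ z₀ : V₀)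
    (hcert : ∀ K₁ K₂ : Set V₀ → Set V₀ → ℝ,
      (∀ ⦃A A' B B' : Set V₀⦄, A ⊆ A' → B' ⊆ B → K₁ A B ≤ K₁ A' B') → (∀ A B, 0 ≤ K₁ A B + K₁ B A) →
      (∀ ⦃A A' B B' : Set V₀⦄, A ⊆ A' → B' ⊆ B → K₂ A B ≤ K₂ A' B') → (∀ A B, 0 ≤ K₂ A B + K₂ B A) →
      0 ≤ ∑ θ ∈ E₁.powerset.filter (fun θ : Finset (Sym2 V₀) =>
          (SimpleGraph.fromEdgeSet (↑θ : Set (Sym2 V₀))).Reachable s₀ y₀ ∧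
            ¬ (SimpleGraph.fromEdgeSet (↑(E₁ \ θ) : Set (Sym2 V₀))).Reachable s₀ z₀),
        K₁ (openCluster (↑θ : Set (Sym2 V₀)) s₀) (openCluster (↑(E₁ \ θ) : Set (Sym2 V₀)) s₀) *
          K₂ (openCluster (↑θ : Set (Sym2 V₀)) s₀) (openCluster (↑(E₁ \ θ) : Set (Sym2 V₀)) s₀))
    {E : Set (Sym2 V)} (hE : E = Sym2.map φ '' ↑E₁)
    (K₁ K₂ : Set V → Set V → ℝ)
    (hK₁ : ∀ ⦃A A' B B' : Set V⦄, A ⊆ A' → B' ⊆ B → K₁ A B ≤ K₁ A' B') (hso₁ : ∀ A B, 0 ≤ K₁ A B + K₁ B A)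
    (hK₂ : ∀ ⦃A A' B B' : Set V⦄, A ⊆ A' → B' ⊆ B → K₂ A B ≤ K₂ A' B') (hso₂ : ∀ A B, 0 ≤ K₂ A B + K₂ B A) :
    0 ≤ ∑ T ∈ Finset.univ.filter (fun T : Set (Sym2 V) =>
        φ y₀ ∈ openCluster (T ∩ E) (φ s₀) ∧ φ z₀ ∉ openCluster (Tᶜ ∩ E) (φ s₀)),
      K₁ (openCluster (T ∩ E) (φ s₀)) (openCluster (Tᶜ ∩ E) (φ s₀)) *
        K₂ (openCluster (T ∩ E) (φ s₀)) (openCluster (Tᶜ ∩ E) (φ s₀)) := by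
  have h := event_sum_of_powerset hφ E₁ s₀ (fun A B => y₀ ∈ A ∧ z₀ ∉ B) (fun A B => φ y₀ ∈ A ∧ φ z₀ ∉ B)
    (fun A B => by rw [hφ.mem_set_image, hφ.mem_set_image]) ?_ hE K₁ K₂ hK₁ hso₁ hK₂ hso₂
  · convert h using 3
  · intro L₁ L₂ hL₁ hsoL₁ hL₂ hsoL₂
    have h' := hcert L₁ L₂ hL₁ hsoL₁ hL₂ hsoL₂
    convert h' using 3
    unfold openCluster openGraph; exact Iff.rfl

end Transport

end Antithetic

end Summit.CriticalPhenomena.PercolationContinuityZ3.Theorems
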